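import Summits.Ventures.PercRepro2.CaseOneRootsAndMark
import Summits.Ventures.PercRepro2.CaseOneRootsOnlyI
import Summits.Ventures.PercRepro2.TypeRB

/-!
# `(i)` and `(J1₁)` when every edge at `a₃` goes to a root or to `o` (blind cell PercRepro2, p1 g19;
S5 (S5.a″) (b) completed on the `(i)` side — the missing face theorem of P1-FACE §5)

The `(i)` mirror of `zSplitII_of_rootsAndO`. In the D-world `D = Q ∩ {a₃ ∉ C₂}` an `a₁a₃`-edge `e₁`
is still free for `(i)`: opening it turns `{b ∈ C₁}` into `{b ∈ C₁} ∪ {b ↔ a₃}` of the pinned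
configuration (`conn_a1_b_update_true_iff`); when every non-root edge at `a₃` goes to `o`, the new
part `{b ↔ a₃} ∖ {b ∈ C₁}` forces `o ∉ C₂` (`conn_a1_b_of_conn_a3_of_rootsAndO`), so the
`o ∈ C₂`-masses do not see it (`union_inter_O_inter_Dw_eq`). Pinning identity (`p₀ = p[e₁ ↦ 0]`,
`iExprD_a1_edge_of_rootsAndO`): `iExprD p = −p₁ c₁ [P₀(D) P₀(D, b ∈ C₁, o ∈ C₂) − P₀(D, b ∈ C₁)
P₀(D, o ∈ C₂)] + (1 − p₁) iExprD p₀ + p₁ (P₀(D, b ∈ C₁ ∨ b ↔ a₃) − P₀(D, b ∈ C₁)) · (c₁ (p₁ P₀(D,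
o ∈ C₂) + (1 − p₁) P₀(D, a₃ ∈ C₁, o ∈ C₂)) + c₀ (1 − p₁) (P₀(D) − P₀(D, a₃ ∈ C₁)))` — the bracket is
BHK 1.4 in the D-world (`covDwI_nonpos`), the rest a product of nonnegative masses; an `a₂a₃`-edge
scales. Base (`a₃` a leaf at `o` in the support): `c₀ · [P(D) P(D, b ∈ C₁, a₃ ∈ C₁) − P(D, b ∈ C₁)
P(D, a₃ ∈ C₁)] ≥ 0` — the `o ∈ C₂`-masses vanish on `{a₃ ∈ C₁}` and the bracket is typer-1's BHK 1.3
for the cluster of `a₁` under the avoidance `a₂ ↮ {a₁, a₃}` (`TypeRB.bhk_other_cluster_avoid`).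
**`zSplitID_of_rootsAndO`, `zSplitI_of_rootsAndO`, `jOneOne_of_rootsAndO`**: `(i)` and `(J1₁)` for
every `a₃` whose edges join the roots (any multiplicities) and `o` (one edge of any weight), every
finite graph, every weight vector. Own code; standard axioms.
-/

namespace Summit.Ventures.PercRepro2

namespace CaseOne

/-! ## The pointwise facts -/

section Pointwise
variable {V : Type*} {E : Type*} [DecidableEq E] {ends : E → Sym2 V} {a₁ a₂ a₃ : V}

omit [DecidableEq E] in
/-- On `D` (roots-and-`o` class), a vertex `x ≠ a₃` joined to `a₃` is joined to `a₁` or to `o`. -/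
lemma conn_a1_or_o_of_conn_a3_of_rootsAndO {o : V}
    (hro : ∀ e, a₃ ∈ ends e → ends e = s(a₁, a₃) ∨ ends e = s(a₂, a₃) ∨ ends e = s(o, a₃))
    {ω : Config E} (hD : ω ∈ Dw ends a₁ a₂ a₃) {x : V} (hx : x ≠ a₃) (h : Conn ends ω x a₃) :
    Conn ends ω x a₁ ∨ Conn ends ω x o := by
  let S : Set V := {y | Conn ends ω x y ∧ (y = a₃ → Conn ends ω x a₁ ∨ Conn ends ω x o)}
  have hS : ∀ y ∈ S, ∀ z, (openGraph ends ω).Adj y z → z ∈ S := by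
    intro y hy z hyz
    obtain ⟨_, e, he, hends⟩ := openGraph_adj.1 hyz
    refine ⟨conn_trans hy.1 (conn_of_openAdj ⟨e, he, hends⟩), fun hz => ?_⟩
    have h3 : a₃ ∈ ends e := by rw [hends, hz]; exact Sym2.mem_mk_right _ _
    rcases hro e h3 with h1 | h2 | ho
    · rw [hz, h1, Sym2.eq_iff] at hends
      rcases hends with ⟨hy1, _⟩ | ⟨hy3, h31⟩
      · left; rw [hy1]; exact hy.1
      · left; rw [hy3, h31]; exact hy.1
    · have hc : ω e = false := update_false_of_mem_Dw (a₁ := a₁) h2 hD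
      rw [hc] at he
      exact Bool.noConfusion he
    · rw [hz, ho, Sym2.eq_iff] at hends
      rcases hends with ⟨hyo, _⟩ | ⟨hy3, h3o⟩
      · right; rw [hyo]; exact hy.1
      · right; rw [hy3, h3o]; exact hy.1
  have hx' : x ∈ S := ⟨conn_refl ends ω x, fun h => absurd h hx⟩
  exact (mem_of_conn_of_closed hS hx' h).2 rfl

omit [DecidableEq E] in
/-- On `D ∩ {o ∈ C₂}` (roots-and-`o` class), a vertex `b ≠ a₃` joined to `a₃` lies in `C₁`. -/
lemma conn_a1_b_of_conn_a3_of_rootsAndO {o : V}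
    (hro : ∀ e, a₃ ∈ ends e → ends e = s(a₁, a₃) ∨ ends e = s(a₂, a₃) ∨ ends e = s(o, a₃))
    {ω : Config E} (hD : ω ∈ Dw ends a₁ a₂ a₃) (hoC₂ : Conn ends ω a₂ o) {b : V} (hb : b ≠ a₃)
    (h : Conn ends ω a₃ b) : Conn ends ω a₁ b := by
  rcases conn_a1_or_o_of_conn_a3_of_rootsAndO hro hD hb (conn_symm h) with h1 | ho
  · exact conn_symm h1
  · exfalso
    have h23 : Conn ends ω a₂ a₃ := conn_trans hoC₂ (conn_trans (conn_symm ho) (conn_symm h))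
    have hD2 := hD.2
    simp only [Set.mem_compl_iff, mem_connEvent] at hD2
    exact hD2 h23

variable {e₁ : E}

omit [DecidableEq E] in
/-- Opening `e₁ = {a₁, a₃}`: `b ∈ C₁` afterwards iff `b ∈ C₁` or `b ↔ a₃` before (any graph). -/
lemma conn_a1_b_update_true_iff [DecidableEq E] (he : ends e₁ = s(a₁, a₃)) (ω₀ : Config E) (b : V) :
    Conn ends (Function.update ω₀ e₁ true) a₁ b ↔ Conn ends ω₀ a₁ b ∨ Conn ends ω₀ a₃ b := by
  rw [OneEdge.conn_update_true_iff he ω₀ a₁ b]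
  constructor
  · rintro (h | ⟨_, h⟩ | ⟨_, h⟩)
    · exact Or.inl h
    · exact Or.inr h
    · exact Or.inl h
  · rintro (h | h)
    · exact Or.inl h
    · exact Or.inr (Or.inl ⟨conn_refl ends ω₀ a₁, h⟩)

/-- `{b ∈ C₁}` pulls back to `{b ∈ C₁} ∪ {b ↔ a₃}` under the opening of `e₁`. -/
lemma b1_event_update_pull (he : ends e₁ = s(a₁, a₃)) (b : V) :
    ∀ ω₀ ∈ Dw ends a₁ a₂ a₃, Function.update ω₀ e₁ true ∈ connEvent ends a₁ b ↔
      ω₀ ∈ connEvent ends a₁ b ∪ connEvent ends a₃ b :=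
  fun ω₀ _ => by
    simp only [mem_connEvent, Set.mem_union]
    exact conn_a1_b_update_true_iff he ω₀ b

/-- A pulled-back event intersected with a qualifying one. -/
lemma inter_event_update_pull {X Y Z : Set (Config E)}
    (hXY : ∀ ω₀ ∈ Dw ends a₁ a₂ a₃, Function.update ω₀ e₁ true ∈ X ↔ ω₀ ∈ Y)
    (hZ : ∀ ω₀ ∈ Dw ends a₁ a₂ a₃, Function.update ω₀ e₁ true ∈ Z ↔ ω₀ ∈ Z) :
    ∀ ω₀ ∈ Dw ends a₁ a₂ a₃, Function.update ω₀ e₁ true ∈ X ∩ Z ↔ ω₀ ∈ Y ∩ Z :=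
  fun ω₀ hD => by
    simp only [Set.mem_inter_iff]
    rw [hXY ω₀ hD, hZ ω₀ hD]

omit [DecidableEq E] in
/-- **The vanishing**: on `D ∩ {o ∈ C₂}` the pulled-back event is `{b ∈ C₁}` again. -/
lemma union_inter_O_inter_Dw_eq {o b : V}
    (hro : ∀ e, a₃ ∈ ends e → ends e = s(a₁, a₃) ∨ ends e = s(a₂, a₃) ∨ ends e = s(o, a₃))
    (hb : b ≠ a₃) :
    (connEvent ends a₁ b ∪ connEvent ends a₃ b) ∩ connEvent ends a₂ o ∩ Dw ends a₁ a₂ a₃ =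
      connEvent ends a₁ b ∩ connEvent ends a₂ o ∩ Dw ends a₁ a₂ a₃ := by
  ext ω
  simp only [Set.mem_inter_iff, Set.mem_union, mem_connEvent]
  constructor
  · rintro ⟨⟨h | h, ho⟩, hD⟩
    · exact ⟨⟨h, ho⟩, hD⟩
    · exact ⟨⟨conn_a1_b_of_conn_a3_of_rootsAndO hro hD ho hb h, ho⟩, hD⟩
  · rintro ⟨⟨h, ho⟩, hD⟩
    exact ⟨⟨Or.inl h, ho⟩, hD⟩

end Pointwise

/-! ## The pinning of an `a₁a₃`-edge for a pulled-back event -/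
section Pin
variable {V : Type*} {E : Type*} [Fintype E] [DecidableEq E] {R : Type*} [CommRing R]
variable {ends : E → Sym2 V} {a₁ a₂ a₃ : V} {e₁ : E}

/-- **The `D`-masses, pulled back**: `P(X ∩ D) = p₁ P₀(Y ∩ D) + (1 − p₁) P₀(X ∩ D)`. -/
lemma prob_inter_Dw_pin_pull (p : E → R) (he : ends e₁ = s(a₁, a₃)) (X Y : Set (Config E))
    (hXY : ∀ ω₀ ∈ Dw ends a₁ a₂ a₃, Function.update ω₀ e₁ true ∈ X ↔ ω₀ ∈ Y) :
    prob p (X ∩ Dw ends a₁ a₂ a₃) =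
      p e₁ * prob (Function.update p e₁ 0) (Y ∩ Dw ends a₁ a₂ a₃) +
        (1 - p e₁) * prob (Function.update p e₁ 0) (X ∩ Dw ends a₁ a₂ a₃) := by
  rw [prob_eq_expect_indicator, expect_eq_update_pin p _ e₁, prob_eq_expect_indicator,
    prob_eq_expect_indicator, expect_update_zero, expect_update_zero]
  have key : (fun ω : Config E => (X ∩ Dw ends a₁ a₂ a₃).indicator
      (1 : Config E → R) (Function.update ω e₁ true)) =
      fun ω => (Y ∩ Dw ends a₁ a₂ a₃).indicator 1 (Function.update ω e₁ false) := by
    funext ω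
    set ω₀ := Function.update ω e₁ false with hω₀
    have hω₁ : Function.update ω e₁ true = Function.update ω₀ e₁ true := by
      rw [hω₀, Function.update_idem]
    have hD : Function.update ω₀ e₁ true ∈ Dw ends a₁ a₂ a₃ ↔ ω₀ ∈ Dw ends a₁ a₂ a₃ := by
      have := mem_Dw_update_iff (a₂ := a₂) he ω
      rw [hω₁] at this
      exact this
    rw [hω₁]
    by_cases hm : ω₀ ∈ Y ∩ Dw ends a₁ a₂ a₃
    · have hm' : Function.update ω₀ e₁ true ∈ X ∩ Dw ends a₁ a₂ a₃ :=
        ⟨(hXY ω₀ hm.2).2 hm.1, hD.2 hm.2⟩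
      simp only [Set.indicator_of_mem hm', Set.indicator_of_mem hm, Pi.one_apply]
    · have hm' : Function.update ω₀ e₁ true ∉ X ∩ Dw ends a₁ a₂ a₃ := by
        intro h
        have hd := hD.1 h.2
        exact hm ⟨(hXY ω₀ hd).1 h.1, hd⟩
      rw [Set.indicator_of_notMem hm', Set.indicator_of_notMem hm]
  rw [key]

/-- **The `A`-masses, pulled back**: `P(X ∩ A ∩ D) = p₁ P₀(Y ∩ D) + (1 − p₁) P₀(X ∩ A ∩ D)`. -/
lemma prob_A_inter_Dw_pin_pull (p : E → R) (he : ends e₁ = s(a₁, a₃)) (X Y : Set (Config E))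
    (hXY : ∀ ω₀ ∈ Dw ends a₁ a₂ a₃, Function.update ω₀ e₁ true ∈ X ↔ ω₀ ∈ Y) :
    prob p (X ∩ connEvent ends a₁ a₃ ∩ Dw ends a₁ a₂ a₃) =
      p e₁ * prob (Function.update p e₁ 0) (Y ∩ Dw ends a₁ a₂ a₃) +
        (1 - p e₁) *
          prob (Function.update p e₁ 0) (X ∩ connEvent ends a₁ a₃ ∩ Dw ends a₁ a₂ a₃) := by
  rw [prob_eq_expect_indicator, expect_eq_update_pin p _ e₁, prob_eq_expect_indicator,
    prob_eq_expect_indicator, expect_update_zero, expect_update_zero]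
  have key : (fun ω : Config E => (X ∩ connEvent ends a₁ a₃ ∩ Dw ends a₁ a₂ a₃).indicator
      (1 : Config E → R) (Function.update ω e₁ true)) =
      fun ω => (Y ∩ Dw ends a₁ a₂ a₃).indicator 1 (Function.update ω e₁ false) := by
    funext ω
    set ω₀ := Function.update ω e₁ false with hω₀
    have hω₁ : Function.update ω e₁ true = Function.update ω₀ e₁ true := by
      rw [hω₀, Function.update_idem]
    have hD : Function.update ω₀ e₁ true ∈ Dw ends a₁ a₂ a₃ ↔ ω₀ ∈ Dw ends a₁ a₂ a₃ := by
      have := mem_Dw_update_iff (a₂ := a₂) he ω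
      rw [hω₁] at this
      exact this
    rw [hω₁]
    by_cases hm : ω₀ ∈ Y ∩ Dw ends a₁ a₂ a₃
    · have hm' : Function.update ω₀ e₁ true ∈ X ∩ connEvent ends a₁ a₃ ∩ Dw ends a₁ a₂ a₃ :=
        ⟨⟨(hXY ω₀ hm.2).2 hm.1, conn_a1_a3_update_true he ω₀⟩, hD.2 hm.2⟩
      simp only [Set.indicator_of_mem hm', Set.indicator_of_mem hm, Pi.one_apply]
    · have hm' : Function.update ω₀ e₁ true ∉ X ∩ connEvent ends a₁ a₃ ∩ Dw ends a₁ a₂ a₃ := by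
        intro h
        have hd := hD.1 h.2
        exact hm ⟨(hXY ω₀ hd).1 h.1.1, hd⟩
      rw [Set.indicator_of_notMem hm', Set.indicator_of_notMem hm]
  rw [key]

end Pin

/-! ## Identity (E) for `(i)` on the roots-and-`o` class -/
section IdentityE
variable {V : Type*} {E : Type*} [Fintype E] [DecidableEq E] {R : Type*} [CommRing R]
variable {ends : E → Sym2 V} {a₁ a₂ a₃ : V} {e₁ : E}

/-- **Identity (E) for `(i)` when every edge at `a₃` joins a root or `o`**: pinning an `a₁a₃`-edge
(the identity of the module docstring; `p₀ = p[e₁ ↦ 0]`). -/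
theorem iExprD_a1_edge_of_rootsAndO (p : E → R) {o : V}
    (hro : ∀ e, a₃ ∈ ends e → ends e = s(a₁, a₃) ∨ ends e = s(a₂, a₃) ∨ ends e = s(o, a₃))
    (he : ends e₁ = s(a₁, a₃)) {b : V} (hb : b ≠ a₃) (c₀ c₁ : R) :
    iExprD p ends o a₁ a₂ a₃ b c₀ c₁ =
      -(p e₁ * c₁ * (prob (Function.update p e₁ 0) (Dw ends a₁ a₂ a₃) *
          prob (Function.update p e₁ 0) (connEvent ends a₁ b ∩ connEvent ends a₂ o ∩
            Dw ends a₁ a₂ a₃) -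
        prob (Function.update p e₁ 0) (connEvent ends a₁ b ∩ Dw ends a₁ a₂ a₃) *
          prob (Function.update p e₁ 0) (connEvent ends a₂ o ∩ Dw ends a₁ a₂ a₃))) +
      (1 - p e₁) * iExprD (Function.update p e₁ 0) ends o a₁ a₂ a₃ b c₀ c₁ +
      p e₁ * (prob (Function.update p e₁ 0) ((connEvent ends a₁ b ∪ connEvent ends a₃ b) ∩
            Dw ends a₁ a₂ a₃) -
          prob (Function.update p e₁ 0) (connEvent ends a₁ b ∩ Dw ends a₁ a₂ a₃)) *
        (c₁ * (p e₁ * prob (Function.update p e₁ 0) (connEvent ends a₂ o ∩ Dw ends a₁ a₂ a₃) +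
            (1 - p e₁) * prob (Function.update p e₁ 0) (connEvent ends a₂ o ∩
              connEvent ends a₁ a₃ ∩ Dw ends a₁ a₂ a₃)) +
          c₀ * (1 - p e₁) * (prob (Function.update p e₁ 0) (Dw ends a₁ a₂ a₃) -
            prob (Function.update p e₁ 0) (connEvent ends a₁ a₃ ∩ Dw ends a₁ a₂ a₃))) := by
  rw [iExprD_eq, iExprD_eq]
  rw [← B₁AO_inter_Dw, ← AO_inter_Dw, ← B₁A_inter_Dw, ← A_inter_Dw]
  have hB := b1_event_update_pull (a₂ := a₂) he b
  have hO := a2_event_update (a₂ := a₂) he o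
  have hBO := inter_event_update_pull hB hO
  have hU := univ_event_update (ends := ends) (a₁ := a₁) (a₂ := a₂) (a₃ := a₃) (e₁ := e₁)
  have hd : prob p (Dw ends a₁ a₂ a₃) = prob (Function.update p e₁ 0) (Dw ends a₁ a₂ a₃) := by
    have := prob_inter_Dw_update p he Set.univ hU 0
    rw [Set.univ_inter] at this
    exact this.symm
  have hdB := prob_inter_Dw_pin_pull p he _ _ hB
  have e1 : connEvent ends a₁ b ∩ connEvent ends a₁ a₃ ∩ connEvent ends a₂ o ∩ Dw ends a₁ a₂ a₃ =
      (connEvent ends a₁ b ∩ connEvent ends a₂ o) ∩ connEvent ends a₁ a₃ ∩ Dw ends a₁ a₂ a₃ := by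
    ext ω; simp only [Set.mem_inter_iff]; tauto
  have e2 : connEvent ends a₁ a₃ ∩ connEvent ends a₂ o ∩ Dw ends a₁ a₂ a₃ =
      connEvent ends a₂ o ∩ connEvent ends a₁ a₃ ∩ Dw ends a₁ a₂ a₃ := by
    ext ω; simp only [Set.mem_inter_iff]; tauto
  have hBAO := prob_A_inter_Dw_pin_pull p he _ _ hBO
  rw [union_inter_O_inter_Dw_eq hro hb] at hBAO
  have hAO := prob_A_inter_Dw_pin p he _ hO
  have hBA := prob_A_inter_Dw_pin_pull p he _ _ hB
  have hA := prob_A_inter_Dw_pin p he _ hU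
  rw [Set.univ_inter, Set.univ_inter] at hA
  rw [e1, e2, hBAO, hAO, hBA, hA, hd, hdB]
  ring

end IdentityE

/-! ## Lifting `ZSplitID` along the root edges, and the base -/
section Order
variable {V : Type*} {E : Type*} [Fintype E] [DecidableEq E] [Fintype V] [DecidableEq V]
  {R : Type*} [Field R] [LinearOrder R] [IsStrictOrderedRing R]
variable {ends : E → Sym2 V} {a₁ a₂ a₃ : V}

/-- **`ZSplitID` lifts along an `a₁a₃`-edge** when every edge at `a₃` joins a root or `o`. -/
theorem zSplitID_of_a1_edge_of_rootsAndO (p : E → R) (hp : IsProbVec p) {e₁ : E} {o : V}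
    (hro : ∀ e, a₃ ∈ ends e → ends e = s(a₁, a₃) ∨ ends e = s(a₂, a₃) ∨ ends e = s(o, a₃))
    (he : ends e₁ = s(a₁, a₃)) {b : V} (hb : b ≠ a₃)
    (h : ZSplitID (Function.update p e₁ 0) ends o a₁ a₂ a₃ b) : ZSplitID p ends o a₁ a₂ a₃ b := by
  unfold ZSplitID at h ⊢
  rw [iExprD_a1_edge_of_rootsAndO p hro he hb, Dpd_a1_edge p he, Dpdo_a1_edge p he o, iExprD_smul]
  have hp0 : IsProbVec (Function.update p e₁ 0) := hp.update e₁ le_rfl zero_le_one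
  have hcov := covDwI_nonpos (Function.update p e₁ 0) hp0 ends o a₁ a₂ a₃ b
  have h1 : 0 ≤ p e₁ := hp.nonneg e₁
  have h2 : 0 ≤ 1 - p e₁ := by linarith [hp.le_one e₁]
  have hD : 0 ≤ Dpd (Function.update p e₁ 0) ends a₁ a₂ a₃ := prob_nonneg hp0 _
  have hDo : 0 ≤ Dpdo (Function.update p e₁ 0) ends o a₁ a₂ a₃ := prob_nonneg hp0 _
  have hY : prob (Function.update p e₁ 0) (connEvent ends a₁ b ∩ Dw ends a₁ a₂ a₃) ≤
      prob (Function.update p e₁ 0) ((connEvent ends a₁ b ∪ connEvent ends a₃ b) ∩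
        Dw ends a₁ a₂ a₃) :=
    prob_mono hp0 (Set.inter_subset_inter_left _ Set.subset_union_left)
  have hdA : prob (Function.update p e₁ 0) (connEvent ends a₁ a₃ ∩ Dw ends a₁ a₂ a₃) ≤
      prob (Function.update p e₁ 0) (Dw ends a₁ a₂ a₃) := prob_mono hp0 Set.inter_subset_right
  have hO : 0 ≤ prob (Function.update p e₁ 0) (connEvent ends a₂ o ∩ Dw ends a₁ a₂ a₃) :=
    prob_nonneg hp0 _
  have hAO : 0 ≤ prob (Function.update p e₁ 0) (connEvent ends a₂ o ∩ connEvent ends a₁ a₃ ∩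
      Dw ends a₁ a₂ a₃) := prob_nonneg hp0 _
  have t1 := mul_nonpos_of_nonneg_of_nonpos (mul_nonneg h1 (mul_nonneg h2 hD)) hcov
  have t2 := mul_nonneg h2 (mul_nonneg h2 h)
  have t3 := mul_nonneg (mul_nonneg h1 (sub_nonneg.2 hY))
    (add_nonneg (mul_nonneg (mul_nonneg h2 hD) (add_nonneg (mul_nonneg h1 hO) (mul_nonneg h2 hAO)))
      (mul_nonneg (mul_nonneg (mul_nonneg h2 hDo) h2) (sub_nonneg.2 hdA)))
  linarith [t1, t2, t3]

/-- **Induction over the root edges at `a₃`** (the `(i)` twin of `zSplitIID_of_rootsAnd`), from any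
base valid when the root edges are null. -/
theorem zSplitID_of_rootsAnd (p : E → R) (hp : IsProbVec p) {e₀ : E} {o b : V}
    (hro : ∀ e, a₃ ∈ ends e → ends e = s(a₁, a₃) ∨ ends e = s(a₂, a₃) ∨ ends e = s(o, a₃))
    (hroot : ∀ e, a₃ ∈ ends e → e ≠ e₀ → ends e = s(a₁, a₃) ∨ ends e = s(a₂, a₃)) (hb : b ≠ a₃)
    (base : ∀ p' : E → R, IsProbVec p' → (∀ e, a₃ ∈ ends e → e ≠ e₀ → p' e = 0) →
      ZSplitID p' ends o a₁ a₂ a₃ b) :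
    ZSplitID p ends o a₁ a₂ a₃ b := by
  generalize hn : (liveRoot p ends a₃ e₀).card = n
  induction n using Nat.strong_induction_on generalizing p with
  | _ n ih =>
    by_cases h0 : liveRoot p ends a₃ e₀ = ∅
    · refine base p hp fun e he hne => ?_
      by_contra hc
      have : e ∈ liveRoot p ends a₃ e₀ := by simp [liveRoot, he, hne, hc]
      rw [h0] at this
      exact absurd this (Finset.notMem_empty e)
    · obtain ⟨e, he⟩ := Finset.nonempty_iff_ne_empty.mpr h0
      have he' : a₃ ∈ ends e ∧ e ≠ e₀ := by
        have := he
        simp only [liveRoot, Finset.mem_filter, Finset.mem_univ, true_and] at this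
        exact ⟨this.1, this.2.1⟩
      have hlt : ((liveRoot p ends a₃ e₀).erase e).card < n := by
        rw [← hn]; exact Finset.card_erase_lt_of_mem he
      have hp0 : IsProbVec (Function.update p e 0) := hp.update e le_rfl zero_le_one
      have hrec := ih _ hlt (Function.update p e 0) hp0 (by rw [liveRoot_update])
      rcases hroot e he'.1 he'.2 with h | h
      · exact zSplitID_of_a1_edge_of_rootsAndO p hp hro h hb hrec
      · exact zSplitID_of_a2_edge p hp h o b hrec

omit [Fintype V] [DecidableEq V] [LinearOrder R] [IsStrictOrderedRing R] in
/-- For `a₃` a leaf at `o` in the support, `{a₃ ∈ C₁} ∩ {o ∈ C₂} ∩ Q` carries no mass. -/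
lemma prob_AO_eq_zero_of_leaf_supp_o {p : E → R} {o : V} {e₀ : E}
    (hl : IsLeafSupp p ends o a₃ e₀) (h1 : a₁ ≠ a₃) {X : Set (Config E)}
    (hX : X ⊆ connEvent ends a₁ a₃ ∩ connEvent ends a₂ o ∩ (connEvent ends a₁ a₂)ᶜ) :
    prob p X = 0 := by
  rw [prob_eq_expect_indicator, expect_congr_supp hl _ (fun _ => (0 : R)) ?_]
  · simp [expect]
  · intro ω hg
    rw [Set.indicator_of_notMem]
    intro hω
    obtain ⟨⟨hA, hO⟩, hQ⟩ := hX hω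
    simp only [mem_connEvent, Set.mem_compl_iff] at hA hO hQ
    apply hQ
    by_cases he : ω e₀ = true
    · have hoa : Conn ends ω o a₃ := conn_of_openAdj ⟨e₀, he, hl.ends_eq⟩
      exact conn_trans (conn_trans hA (conn_symm hoa)) (conn_symm hO)
    · have he' : ω e₀ = false := by simpa using he
      exact absurd (eq_of_conn_good hg he' (conn_symm hA)) h1

/-- **The base: `ZSplitID` for `a₃` a leaf at `o` in the support.** -/
theorem zSplitID_of_leaf_supp_o {p : E → R} (hp : IsProbVec p) {o : V} {e₀ : E}
    (hl : IsLeafSupp p ends o a₃ e₀) (h1 : a₁ ≠ a₃) (b : V) : ZSplitID p ends o a₁ a₂ a₃ b := by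
  unfold ZSplitID
  rw [iExprD_eq]
  rw [prob_AO_eq_zero_of_leaf_supp_o hl h1 (X := connEvent ends a₁ b ∩ connEvent ends a₁ a₃ ∩
      connEvent ends a₂ o ∩ (connEvent ends a₁ a₂)ᶜ) (fun ω h => ⟨⟨h.1.1.2, h.1.2⟩, h.2⟩),
    prob_AO_eq_zero_of_leaf_supp_o hl h1 (X := connEvent ends a₁ a₃ ∩ connEvent ends a₂ o ∩
      (connEvent ends a₁ a₂)ᶜ) (fun _ h => h)]
  have hbhk := TypeRB.bhk_other_cluster_avoid p ends hp a₂ a₁ (X := ({a₁, a₃} : Finset V)) (by simp)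
    (isUpperSet_mem_setOf b) (isUpperSet_mem_setOf a₃)
  rw [← connEvent_eq_clusterInEvent ends a₁ b, ← connEvent_eq_clusterInEvent ends a₁ a₃,
    ← Dw_eq_avoidAll, B₁A_inter_Dw, A_inter_Dw] at hbhk
  have hDo : 0 ≤ Dpdo p ends o a₁ a₂ a₃ := prob_nonneg hp _
  have key : 0 ≤ prob p (Dw ends a₁ a₂ a₃) *
      prob p (connEvent ends a₁ b ∩ connEvent ends a₁ a₃ ∩ (connEvent ends a₁ a₂)ᶜ) -
      prob p (connEvent ends a₁ b ∩ Dw ends a₁ a₂ a₃) *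
        prob p (connEvent ends a₁ a₃ ∩ (connEvent ends a₁ a₂)ᶜ) := by linarith [hbhk]
  have := mul_nonneg hDo key
  linarith [this]

end Order

/-! ## The theorems -/

section Marked
variable {V : Type*} {E : Type*} [Fintype E] [DecidableEq E] [Fintype V] [DecidableEq V]
  {R : Type*} [Field R] [LinearOrder R] [IsStrictOrderedRing R]
variable {ends : E → Sym2 V} {a₁ a₂ a₃ : V} {e₀ : E}

/-- **`ZSplitID` for `a₃` adjacent to the roots (any multiplicities) and to `o`** through `e₀`. -/
theorem zSplitID_of_rootsAndO (p : E → R) (hp : IsProbVec p) {o : V} (he₀ : ends e₀ = s(o, a₃))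
    (hroot : ∀ e, a₃ ∈ ends e → e ≠ e₀ → ends e = s(a₁, a₃) ∨ ends e = s(a₂, a₃)) (ho : o ≠ a₃)
    (h1 : a₁ ≠ a₃) {b : V} (hb : b ≠ a₃) : ZSplitID p ends o a₁ a₂ a₃ b := by
  have hro : ∀ e, a₃ ∈ ends e → ends e = s(a₁, a₃) ∨ ends e = s(a₂, a₃) ∨ ends e = s(o, a₃) := by
    intro e he
    by_cases hee : e = e₀
    · right; right; rw [hee, he₀]
    · rcases hroot e he hee with h | h
      · exact Or.inl h
      · exact Or.inr (Or.inl h)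
  refine zSplitID_of_rootsAnd p hp hro hroot hb fun p' hp' hnull => ?_
  exact zSplitID_of_leaf_supp_o hp' ⟨he₀, hnull, ho⟩ h1 b

/-- **`(i)` for `a₃` adjacent to the roots (any multiplicities) and to `o`** through `e₀`, every
finite graph, every weight vector (the missing face theorem of P1-FACE §5). -/
theorem zSplitI_of_rootsAndO (p : E → R) (hp : IsProbVec p) {o : V} (he₀ : ends e₀ = s(o, a₃))
    (hroot : ∀ e, a₃ ∈ ends e → e ≠ e₀ → ends e = s(a₁, a₃) ∨ ends e = s(a₂, a₃)) (ho : o ≠ a₃)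
    (h1 : a₁ ≠ a₃) {b : V} (hb : b ≠ a₃) : ZSplitI p ends o a₁ a₂ a₃ b :=
  zSplitI_of_dworld p hp ends o a₁ a₂ a₃ b (zSplitID_of_rootsAndO p hp he₀ hroot ho h1 hb)

/-- **`(J1₁)` for `a₃` adjacent to the roots (any multiplicities) and to `o`**: `(i)` + `(ii)`. -/
theorem jOneOne_of_rootsAndO (p : E → R) (hp : IsProbVec p) {o : V} (he₀ : ends e₀ = s(o, a₃))
    (hroot : ∀ e, a₃ ∈ ends e → e ≠ e₀ → ends e = s(a₁, a₃) ∨ ends e = s(a₂, a₃)) (ho : o ≠ a₃)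
    (h1 : a₁ ≠ a₃) (h2 : a₂ ≠ a₃) {b : V} (hb : b ≠ a₃) : JOneOne p ends o a₁ a₂ a₃ b :=
  jOneOne_of_i_of_ii p ends o a₁ a₂ a₃ b (zSplitI_of_rootsAndO p hp he₀ hroot ho h1 hb)
    (zSplitII_of_rootsAndO p hp he₀ hroot ho h1 h2 hb)

end Marked

end CaseOne

end Summit.Ventures.PercRepro2
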